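import Mathlib
import HarnessLib
import Literature.Computability.QuantumComplexity.AaronsonAmbainisSimTreeBounds
import Literature.Probability.ODonnellSaksSchrammServedio2005.DecisionTreeCovariance
import Literature.Computability.QuantumComplexity.AaronsonAmbainisL1Form
import Summits.QuantumAdvantage.QuantumAdvantage.Theorems.SoloInformedApproximationInfluence

/-!
# Simulation ⟺ Aaronson–Ambainis: the clipped reduced normal form and averaging bookkeeping
# (solo-informed, file 39a; support for `SoloInformedSimulationIffAA.lean`, file 39b)

Solo seat `solo-QuantumAdvantage-informed`, session 17 (§4.33 (2) of the seat's paper).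

(1) NORMAL FORM (`exists_reduced_clamp`, `exists_reduced_clamp_all`): every `RealDecisionTree N`
is computed, after clipping its output to `[0,1]`, by a REDUCED
`Literature.Probability.ODonnellSaksSchrammServedio2005.DTree` (no variable queried twice on a
root–leaf path) of no larger depth — proved by induction on the tree relative to a partial
assignment of the already-queried variables.  This is the without-loss normalisation needed to
apply the OSSS-based `L²`-approximation ⟹ influence theorem of file 38
(`ApproximationInfluence.var_sq_le_of_sq_influence`) to an arbitrary simulating tree.

(2) BOOKKEEPING: `clamp_sq_bounds` (clipping to `[0,1]` does not increase the squared distance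
to a `[0,1]`-valued target, and keeps it `≤ 1`), `card_cube`, `sum_deriv_sq_eq` (the cube sum of
`(D_j p)²` is `2^N · Inf_j[p] / 4` for the tree's `influence`), `var_eq_boolVariance` (the
normalised centred square sum of `evalBool p` is the tree's `boolVariance p`),
`sum_centered_sq_le_card` (a `[0,1]`-valued function on the cube has centred square sum `≤ 2^N`).

Trust base: Mathlib only (every imported Literature declaration used is a definition or a fully
proved theorem).  Route from here to the summit `BQP ⊄ BPP`: none (support file).
-/

namespace Summit.QuantumAdvantage.QuantumAdvantage.Theorems

namespace SimulationNormalForm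

open Finset Function
open Literature.Computability.QuantumComplexity
open Literature.Probability.ODonnellSaksSchrammServedio2005
open Literature.Probability.ODonnellSaksSchrammServedio2005.DTree

/-! ### Normal form: clip to `[0,1]` and reduce, without increasing the depth -/

/-- Every real decision tree is computed, after clipping its output to `[0,1]`, by a REDUCED
`DTree` of no larger depth; version relative to a partial assignment `ρ` of already-queried
variables (the tree produced avoids `ρ`'s domain and agrees with the clipped original on inputs
consistent with `ρ`). -/
theorem exists_reduced_clamp {N : ℕ} (t : RealDecisionTree N) :
    ∀ ρ : Fin N → Option Bool, ∃ T : DTree N, T.Reduced ∧ (∀ j ∈ T.vars, ρ j = none) ∧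
      T.depth ≤ t.depth ∧ (∀ y, 0 ≤ T.eval y ∧ T.eval y ≤ 1) ∧
      ∀ x : Cube N, (∀ j b, ρ j = some b → x j = b) →
        T.eval x = max 0 (min 1 (t.eval x)) := by
  induction t with
  | leaf r =>
    intro ρ
    refine ⟨DTree.leaf (max 0 (min 1 r)), trivial, ?_, ?_, ?_, ?_⟩
    · intro j hj; simp [DTree.vars] at hj
    · simp [DTree.depth, RealDecisionTree.depth]
    · intro y
      exact ⟨le_max_left _ _, max_le zero_le_one (min_le_left _ _)⟩
    · intro x _; rfl
  | query i t₀ t₁ ih₀ ih₁ =>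
    intro ρ
    rcases hρ : ρ i with _ | b
    · obtain ⟨T₀, hR₀, hv₀, hd₀, hb₀, he₀⟩ := ih₀ (update ρ i (some false))
      obtain ⟨T₁, hR₁, hv₁, hd₁, hb₁, he₁⟩ := ih₁ (update ρ i (some true))
      have hi₀ : i ∉ T₀.vars := fun hi => by simpa using hv₀ i hi
      have hi₁ : i ∉ T₁.vars := fun hi => by simpa using hv₁ i hi
      refine ⟨DTree.node i T₀ T₁, ?_, ?_, ?_, ?_, ?_⟩
      · show i ∉ T₀.vars ∧ i ∉ T₁.vars ∧ T₀.Reduced ∧ T₁.Reduced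
        exact ⟨hi₀, hi₁, hR₀, hR₁⟩
      · intro j hj
        simp only [DTree.vars, Finset.mem_insert, Finset.mem_union] at hj
        rcases hj with rfl | hj | hj
        · exact hρ
        · by_cases hji : j = i
          · subst hji; exact hρ
          · simpa [hji] using hv₀ j hj
        · by_cases hji : j = i
          · subst hji; exact hρ
          · simpa [hji] using hv₁ j hj
      · simp only [DTree.depth, RealDecisionTree.depth]
        exact Nat.add_le_add_right (max_le_max hd₀ hd₁) 1
      · intro y
        simp only [DTree.eval]
        split_ifs
        · exact hb₁ y
        · exact hb₀ y
      · intro x hx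
        simp only [DTree.eval, RealDecisionTree.eval]
        by_cases hxi : x i = true
        · rw [if_pos hxi, if_pos hxi]
          refine he₁ x fun j b hjb => ?_
          by_cases hji : j = i
          · subst hji
            simp only [update_self, Option.some.injEq] at hjb
            rw [← hjb]; exact hxi
          · exact hx j b (by simpa [hji] using hjb)
        · rw [if_neg hxi, if_neg hxi]
          have hxf : x i = false := by simpa using hxi
          refine he₀ x fun j b hjb => ?_
          by_cases hji : j = i
          · subst hji
            simp only [update_self, Option.some.injEq] at hjb
            rw [← hjb]; exact hxf
          · exact hx j b (by simpa [hji] using hjb)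
    · cases b with
      | false =>
        obtain ⟨T₀, hR₀, hv₀, hd₀, hb₀, he₀⟩ := ih₀ ρ
        refine ⟨T₀, hR₀, hv₀, ?_, hb₀, ?_⟩
        · simp only [RealDecisionTree.depth]
          exact hd₀.trans ((le_max_left _ _).trans (Nat.le_succ _))
        · intro x hx
          have hxi : ¬ (x i = true) := by rw [hx i false hρ]; decide
          simp only [RealDecisionTree.eval]
          rw [if_neg hxi]
          exact he₀ x hx
      | true =>
        obtain ⟨T₁, hR₁, hv₁, hd₁, hb₁, he₁⟩ := ih₁ ρ
        refine ⟨T₁, hR₁, hv₁, ?_, hb₁, ?_⟩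
        · simp only [RealDecisionTree.depth]
          exact hd₁.trans ((le_max_right _ _).trans (Nat.le_succ _))
        · intro x hx
          have hxi : x i = true := hx i true hρ
          simp only [RealDecisionTree.eval]
          rw [if_pos hxi]
          exact he₁ x hx

/-- The normal form at the empty assignment: a reduced tree with labels in `[0,1]`, depth at most
that of `t`, computing `clamp_{[0,1]} ∘ t.eval`. -/
theorem exists_reduced_clamp_all {N : ℕ} (t : RealDecisionTree N) :
    ∃ T : DTree N, T.Reduced ∧ T.depth ≤ t.depth ∧ (∀ y, 0 ≤ T.eval y ∧ T.eval y ≤ 1) ∧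
      ∀ x : Cube N, T.eval x = max 0 (min 1 (t.eval x)) := by
  obtain ⟨T, hR, -, hd, hb, he⟩ := exists_reduced_clamp t (fun _ => none)
  exact ⟨T, hR, hd, hb, fun x => he x fun j b h => by simp at h⟩

/-! ### Pointwise and averaged bookkeeping -/

/-- Clipping to `[0,1]` never increases the distance to a point of `[0,1]`, and that distance is
at most `1`. -/
theorem clamp_sq_bounds {a : ℝ} (ha0 : 0 ≤ a) (ha1 : a ≤ 1) (r : ℝ) :
    (a - max 0 (min 1 r)) ^ 2 ≤ 1 ∧ (a - max 0 (min 1 r)) ^ 2 ≤ (a - r) ^ 2 := by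
  rcases le_total r 0 with hr | hr
  · have h2 : max 0 (min 1 r) = 0 := by
      rw [min_eq_right (by linarith : r ≤ 1)]; exact max_eq_left hr
    rw [h2]
    constructor <;> nlinarith
  · rcases le_total r 1 with hr1 | hr1
    · have h2 : max 0 (min 1 r) = r := by rw [min_eq_right hr1, max_eq_right hr]
      rw [h2]
      constructor <;> nlinarith
    · have h2 : max 0 (min 1 r) = 1 := by rw [min_eq_left hr1, max_eq_right zero_le_one]
      rw [h2]
      constructor <;> nlinarith

/-- The cube `Fin N → Bool` has `2^N` points (real form). -/
theorem card_cube (N : ℕ) : (Fintype.card (Cube N) : ℝ) = (2 : ℝ) ^ N := by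
  simp [Cube, Fintype.card_bool, Fintype.card_fin]

/-- The tree's influence `Inf_j[p] = E (p(X) − p(X^j))²` is `4 E (D_j p)²`, sum form:
`Σ_z (D_j p (z))² = 2^N · Inf_j[p] / 4`. -/
theorem sum_deriv_sq_eq {N : ℕ} (j : Fin N) (p : MvPolynomial (Fin N) ℝ) :
    ∑ z : Cube N, (deriv j (evalBool p) z) ^ 2 = (2 : ℝ) ^ N * influence j p / 4 := by
  have hpt : ∀ z : Cube N, (deriv j (evalBool p) z) ^ 2
      = (evalBool p z - evalBool p (flipBit j z)) ^ 2 / 4 := by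
    intro z
    unfold Literature.Probability.ODonnellSaksSchrammServedio2005.deriv flipBit
    cases hz : z j
    · have hu : update z j false = z := by rw [← hz]; exact update_eq_self j z
      rw [hu]
      simp only [Bool.not_false]
      ring
    · have hu : update z j true = z := by rw [← hz]; exact update_eq_self j z
      rw [hu]
      simp only [Bool.not_true]
      ring
  rw [Finset.sum_congr rfl fun z _ => hpt z, ← Finset.sum_div]
  unfold influence boolAvg
  have h2 : (2 : ℝ) ^ N ≠ 0 := by positivity
  field_simp

/-- The seat's sum-form variance is the tree's `boolVariance`. -/
theorem var_eq_boolVariance {N : ℕ} (p : MvPolynomial (Fin N) ℝ) :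
    (∑ y : Cube N, (evalBool p y - (∑ z : Cube N, evalBool p z) / (Fintype.card (Cube N) : ℝ)) ^ 2)
        / (Fintype.card (Cube N) : ℝ) = boolVariance p := by
  rw [card_cube]
  rfl

/-- A `[0,1]`-valued function has sum-form variance at most `1`:
`Σ (g − μ)² ≤ card`. -/
theorem sum_centered_sq_le_card {N : ℕ} (g : Cube N → ℝ) (hg : ∀ x, 0 ≤ g x ∧ g x ≤ 1) :
    ∑ y, (g y - (∑ z, g z) / (Fintype.card (Cube N) : ℝ)) ^ 2 ≤ (Fintype.card (Cube N) : ℝ) := by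
  have hN : 0 < (Fintype.card (Cube N) : ℝ) := by exact_mod_cast Fintype.card_pos
  have hμ0 : 0 ≤ (∑ z, g z) / (Fintype.card (Cube N) : ℝ) :=
    div_nonneg (sum_nonneg fun z _ => (hg z).1) hN.le
  have hμ1 : (∑ z, g z) / (Fintype.card (Cube N) : ℝ) ≤ 1 := by
    rw [div_le_one hN]
    calc ∑ z, g z ≤ ∑ _z : Cube N, (1 : ℝ) := sum_le_sum fun z _ => (hg z).2
      _ = (Fintype.card (Cube N) : ℝ) := by simp
  calc ∑ y, (g y - (∑ z, g z) / (Fintype.card (Cube N) : ℝ)) ^ 2 ≤ ∑ _y : Cube N, (1 : ℝ) := by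
        refine sum_le_sum fun y _ => ?_
        have h0 := (hg y).1
        have h1 := (hg y).2
        nlinarith
    _ = (Fintype.card (Cube N) : ℝ) := by simp

end SimulationNormalForm

end Summit.QuantumAdvantage.QuantumAdvantage.Theorems
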